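import Summits.QuantumFields.YangMills.Theorems.BalabanUVNodesK0FlatPortKernelRowsP
import Summits.QuantumFields.YangMills.Theorems.BalabanUVNodesK0FlatOpsHRowsFromKernelsP
import HarnessLib

/-!
# K0⁷ `stub_prop8StepCoP13` (stmt-QuantumFields-20541), sub-target S5, S5 ROAD item (b′) — the d-generic port, file P11 (REPAIR of the S5 socket chain, LOCATED-S5-2):
# **THE PORT-SHAPED `H`-ROWS WITH THE (2.60) LEVEL SEPARATION OF THE PORT DISTANCE EXPORTED** — `∃ dBI ≥ distBI` CARRYING, besides (162) `RowSum162` and the (161)₁ kernel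
# rows `HKernelRows` ∕ letters `HDecayLetterD`, THE WALK FORM OF [Balaban1984PropagatorsII] (2.2): `(R·L·M_h − 1)·(i − j(c) − 1) ≤ dBI(b, c)` whenever `b₋ ∈ Ω_i` and `j(c) < i`

Cell `pub-ymgap`, width seat `pub-ymgap-k0-s1-w3` gen 3 (D-0149; START LIST v8 §k0-s1; bus LOCATED-S5-2 + CLAIM-1 INBOX l.27620).  `--kind proof --supports stmt-QuantumFields-20541
--as helper`; count-neutral; def-free.  WHY (LOCATED-S5-2, this seat's own lineage): file P10 `K0S5HBRowsAtRecordTori.hbRows164_levelRadii_cubeSeq_T4` (p597524) — the S5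
socket — exports the port distance only as `∃ dBI, distBI ≤ dBI ∧ …` and then asks of every FAR cell `G·(k − j(c) − g) ≤ dBI b c` with `2 ≤ e^{τG}`, `τ ≤ ½δ₀` (so `G > 0`);
but `distBI` (the PHYSICAL unit-scale distance, `FlatCubeOpsText.distBI`) is bounded on the tower (144) uniformly in the level difference (`FlatCubeSequence.rad_add_le`), so that
clause is not derivable from what was exported.  The port's witness `dBI = d_T(blkV1 b, β c) + 3` (file P8 `K0FlatPortKernelRowsP.kernelRowsAt_domT`, l.279) — Bałaban's (2.46)
block-graph distance of lit-balaban's `B6Geom246MultiLevelTorusL0` — DOES satisfy it: the walk form of (2.2) `levelGapT : LevelGap (bondT D) (·.1.1) (R·L·M_h − 1)` with the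
combinatorial (2.47)–(2.48) ⇒ (2.60) bound `B6Geometry.levelGap_dist` gives `d_T(blkV1 b, β c) ≥ (R·L·M_h − 1)·(lev b₋ − j(c) − 1)`.  THIS FILE re-runs the P8 assembly VERBATIM
(its helper theorems `hKernelRows_of_rows` ∕ `globalBand_unitWeights` ∕ `unitWeights_pos` and files P4–P7 BY NAME) with that one conjunct added to the existential, charts it to
every `Adm22` family (P8's `…_of_adm22` step verbatim), pushes it through P3's `hRows_of_kernelRows` to the (161)₁ letters, and reads it on NODE 00's four-tori.

THE PRINT.  [Balaban1984PropagatorsII] p. 224 (2.2): *«(Lʲη)⁻¹ dist(Ω_jᶜ, Ω_{j+1}) > RM»*; p. 231 (2.46): *«d(y, y′) = inf_Γ |Γ| … built of admissible bonds»*; p. 233 (2.57):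
*«(L^{j_{l,l+1}}η)⁻¹|y′_l − y_{l+1}| > RM»*; p. 234 (2.60): *«e^{−αδ₀d(y,y′)} ≤ e^{−αδ₀RM max{|j−j′|−1,0}}, y ∈ Λ_j, y′ ∈ Λ_{j′}»*.  [Balaban1985Variational] p. 303 (162)–(163): the
layer geometry is what makes «R₁M₁ sufficiently big» pay the far cells.

WHAT IS PROVED (sorry-free; axioms standard; no definition):
* §1 `levelSep_dT` — for the charted family `domT hN D hk`: `b₋ ∈ Ω_i` (`(domT …).InOm i b.src`, `i ≤ k`) and `j(c) < i` ⇒ `(R·L·M_h − 1)·(i − j(c) − 1) ≤ d_T(blkV1 b, β c)`;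
* §2 ★ `kernelRowsSep_domT` — P8's `kernelRowsAt_domT` with the distance's existential carrying FOUR conjuncts: `distBI ≤ dBI`, the LEVEL SEPARATION above for `dBI`, (162)
  `RowSum162`, the four kernel rows `HKernelRows` (+ the `G` rows, unchanged); ★ `kernelRowsSep_of_adm22` — the same at every `Adm22 D R (L·M_h)` family of `PV d ℓ m K` (level-0
  chart `FlatPortChartL0.domT_tdOfAdmL0`), the separation phrased on `D.InOm`;
* §3 ★ `hRowsSep_of_adm22` — through P3: the guarded (46) letter, the (130) Laplacian row, and `∃ dBI` with `distBI ≤ dBI` ∧ SEPARATION ∧ `RowSum162 … δ₀ B₃` ∧ the four (161)₁ rows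
  `HDecayLetterD … (max C (C·B₃)) δ₀`;
* §4 ★★ `hRowsSep_of_adm22_T4 (F : T4Family)` — on NODE 00's tori `F.P K = PV 3 ℓ F.m K` (`rfl`): for all heights `1 ≤ K − n`, `K − n + 1 ≤ F.m + K`, `M_h = L^{a′} ≥ M_h⁰`, `R ≥ R₀`,
  `a′ + 3 ≤ F.m + n`, every `D` with `D.k = K − n`, `Adm22 D R (L·M_h)`, every level-weight family: `∃ dBI ≥ distBI` with `(R·L·M_h − 1)·(i − j(c) − 1) ≤ dBI b c` for `b₋ ∈ Ω_i`,
  `j(c) < i ≤ K − n`, (162) at `(½δ₀, B₃)` and (161)₁ at `(C, δ₀)` — the input of the repaired S5 socket (file P12).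
HONEST FRAMING: count-neutral helper; nothing of [Balaban1985Variational] Sect. F is asserted; the content is lit-balaban's kernel-checked [Balaban1984PropagatorsII] chain, consumed by
name; K0⁷ OPEN; N07 NOT discharged (5∕27 unmoved); one finite 𝕋⁴ programme at fixed ε — R4 closes the conditional finite-𝕋⁴ rung `BalabanLadder.UV` only; the YM mass gap (Clay) is
NOT proved by any of this; nothing continuum ∕ ℝ⁴ ∕ OS.

References: T. Bałaban, CMP **96** (1984) 223–250 [Balaban1984PropagatorsII] (2.1)–(2.4) p.224, (2.45)–(2.48) pp.231–232, (2.57) p.233, Lemma 2.1 (2.60)–(2.63) p.234, Prop. 2.6 (2.136)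
p.247, Prop. 2.7 (2.149), Cor. 2.8 (2.150)–(2.151) p.249; CMP **102** (1985) 277–309 [Balaban1985Variational] (46) p.285, (130) p.298, (161)–(163) p.303; CMP **109** (1987) 249–301
[Balaban1987RG1] (0.1) p.251.
-/

set_option autoImplicit false

noncomputable section

open scoped BigOperators InnerProductSpace

namespace Summit.QuantumFields.YangMills.Theorems.K0FlatPortKernelRowsSepP

open FlatPortKernelRows (kernel_bound_mono)
open K0FlatPortBudgetsP (theta_budget absorb_budget chart_params)

open Literature.MathematicalPhysics.QuantumFieldTheory.Balaban1983to89
open Literature.MathematicalPhysics.QuantumFieldTheory.BalabanImbrieJaffe1984to88.BIJ85AxialPropagator411 (BondSpace)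
open B6MultiLevelBoxOperator (N0)
open B6MultiLevelTorusOperatorL0 (TDomains)
open B6Geom246MultiLevelBoxL0 (bset)
open B6Geom246MultiLevelTorusL0 (geomT bondT lemma21_torus levelGapT connectedT)
open B6Geometry (levelGap_dist)
open B6GlobalChartV1 (PV toBox)
open B6GlobalChartV1L0 (blkV1 domT iterBlockOf_mem_domT_iff)
open B6Ineq2142KLevelV1L0 (lvl lvl_le β beta_level)
open B6Ineq2133TwoScaleV1 (onFun)
open B6GradLegKLevelV1 (DV)
open B6LapLegKLevelV1 (LapV)
open B6RandomWalk (HasMajorant delta3 delta3_pos)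
open B6Lemma21Repaired (Ineq261With Ineq263With)
open B6Ineq261LevelGap (K261 K261_nonneg theta_lt_one_of_log)
open B6Prop26KLevelSkeletonV1L0 (pref)
open B6Prop27KLevelV1L0 (lam)
open B6Cor28KLevelV1 (absorb_threshold two_le_RMh)
open B6QGQCoerciveKLevelV1 (gam0 gam0_pos)
open B6CubeWindowV1 (GlobalBand)
open B6SectADomainsV1 (Domains)
open B6SectAOperatorsV1 (BondIdx QsE dcE dcsE)
open B6SectAVectorModelV1 (GE EE)
open FlatCubeOpsText (Adm22 distBI)
open Summit.QuantumFields.YangMills.Theorems.K0FlatCubeOpsTextP (IsLevWeight RowSum162 flatH HKernelRows IsFlatGW GtSupLetterG GtLaplaceLetterG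
  HSupLetterG HLapLetterG HDecayLetterD hd4)
open FlatPortDistanceL0 (distBI_domT_le)
open FlatPortHRows12 (cf_ne_zero)
open K0FlatPortHRows12P (hRows12_of_cor28Shape)
open FlatPortCor28PadL0 (cor28_kLevel_H_DH_pad)
open FlatPortProp27PadL0 (prop27_kLevel_pad)
open K0FlatPortRowSumP (rowSum162_domT)
open K0FlatPortHRows34P (hRow3_of_portShapes hRow4_of_portShapes)
open K0FlatPortGRowsP (gRows_of_portShapes)
open B6Prop26LapKLevelV1L0 (prop26_2136_lap_kLevel_unconditional_pad_V1)
open K0FlatPortKernelRowsP (hKernelRows_of_rows globalBand_unitWeights unitWeights_pos)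
open K0FlatOpsHRowsFromKernelsP (hRows_of_kernelRows)
open T4Continuum (T4Family)

/-! ## §1 The (2.60) level separation of the port distance `d_T(blkV1 b, β c)` -/

section Carrier

variable (d ℓ : ℕ) (hd : 1 ≤ d + 1) (hL : Odd (ℓ + 1) ∧ 1 < ℓ + 1) (m : ℕ) (n K : ℕ)
variable {Mh R : ℕ} {P' : Fin (d + 1) → ℕ}
variable (hN : ∀ μ, N0 ℓ Mh (K - n) P' μ = (PV d ℓ m K hd hL).sitesPerDir 0) (D : TDomains d ℓ Mh (K - n) P' R) (hk : K - n ≤ m + K)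

/-- **(2.60), WALK FORM, FOR THE PORT DISTANCE**: if the fine bond `b` starts inside `Ω_i` (`i ≤ k`) and the index bond `c` sits at a level `j(c) < i`, then Bałaban's block-graph
distance between the block of `b₋` and the carrier block of `c` is at least `(R·L·M_h − 1)·(i − j(c) − 1)` — every full layer `Λ_{j′}`, `j(c) < j′ < i`, costs `R·L·M_h − 1` admissible
bonds (lit-balaban `levelGapT` + `B6Geometry.levelGap_dist`). [cite: Balaban1984PropagatorsII, (2.2) p.224, (2.46)–(2.48) pp.231–232, (2.57) p.233, (2.60) p.234] -/
theorem levelSep_dT (hMh : 1 ≤ Mh) (hP : ∀ μ, 1 ≤ P' μ) {i : ℕ} (hi : i ≤ K - n) (b : PBond (PV d ℓ m K hd hL) 0)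
    (c : BondIdx (B6GlobalChartV1L0.domT hN D hk)) (hb : (domT hN D hk).InOm i b.src) (hc : (c.1.1 : ℕ) < i) :
    ((R * ((ℓ + 1) * Mh) - 1 : ℕ) : ℝ) * ((i : ℝ) - (c.1.1 : ℕ) - 1) ≤ ((bondT D).dist (blkV1 hN D b) (β hN D hk c) : ℝ) := by
  have hzb : i ≤ (blkV1 hN D b).1.1 := (iterBlockOf_mem_domT_iff hN D hk hi b.src).1 hb
  have hzc : (β hN D hk c).1.1 = (c.1.1 : ℕ) := beta_level hN D hk c
  have hlt : (β hN D hk c).1.1 < (blkV1 hN D b).1.1 := by omega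
  have h := levelGap_dist (connectedT (D := D) hMh hP) (levelGapT D) hlt
  rw [SimpleGraph.dist_comm] at h
  have h1 : i - (c.1.1 : ℕ) - 1 ≤ (blkV1 hN D b).1.1 - (β hN D hk c).1.1 - 1 := by omega
  have h2 : (R * ((ℓ + 1) * Mh) - 1) * (i - (c.1.1 : ℕ) - 1) ≤ (bondT D).dist (blkV1 hN D b) (β hN D hk c) :=
    le_trans (Nat.mul_le_mul_left _ h1) h
  have hcast : ((i - (c.1.1 : ℕ) - 1 : ℕ) : ℝ) = (i : ℝ) - (c.1.1 : ℕ) - 1 := by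
    rw [Nat.cast_sub (by omega), Nat.cast_sub (by omega)]; push_cast; ring
  have h3 := (Nat.cast_le (α := ℝ)).2 h2
  rw [Nat.cast_mul, hcast] at h3
  exact h3

end Carrier

/-! ## §2 The P8 assembly re-run with the separation conjunct exported -/

/-- ★ **`HKernelRows` ∕ `RowSum162` AT EVERY CHARTED FAMILY, THE (2.60) LEVEL SEPARATION OF THE DISTANCE EXPORTED** (file P8's `kernelRowsAt_domT` with one conjunct added to the
existential, proof verbatim): for odd `L = ℓ + 1 ≥ 5` there are `M_h⁰, R₀` and `C ≥ 0`, `δ₀ > 0`, `B₃ > 0`, `C_G ≥ 0` (functions of `d, L`) such that for every height `1 ≤ k = K − n`, every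
torus family `D : TDomains d ℓ M_h k P′ R` with `M_h = Lᵃ ≥ M_h⁰`, `R ≥ R₀`, `P′ = L·P″`, `P″ ≥ 5`, and every P2 weight family: THERE IS `dBI` with `distBI ≤ dBI`,
`(R·L·M_h − 1)·(i − j(c) − 1) ≤ dBI b c` for `b₋ ∈ Ω_i`, `j(c) < i ≤ k`, (162) `RowSum162 … dBI w δ₀ B₃`, the four kernel rows `HKernelRows … dBI w flatH C δ₀`; and the `G` rows at `C_G`.
[cite: Balaban1984PropagatorsII, (2.2) p.224, (2.46) p.231, (2.60) p.234, Cor. 2.8 (2.150)-(2.151) p.249, Prop. 2.7 (2.149) p.249, Prop. 2.6 (2.136) p.247; Balaban1985Variational, (161)-(163) p.303] -/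
theorem kernelRowsSep_domT (d ℓ : ℕ) (hd : 1 ≤ d + 1) (hL : Odd (ℓ + 1) ∧ 1 < ℓ + 1) (hℓ : 4 ≤ ℓ) :
    ∃ (Mh₀ R₀ : ℕ) (C δ₀ B₃ CG : ℝ), 0 ≤ C ∧ 0 < δ₀ ∧ 0 < B₃ ∧ 0 ≤ CG ∧
    ∀ (m : ℕ) (n K : ℕ) {Mh R : ℕ} {P' : Fin (d + 1) → ℕ} (hN : ∀ μ, N0 ℓ Mh (K - n) P' μ = (PV d ℓ m K hd hL).sitesPerDir 0)
      (D : TDomains d ℓ Mh (K - n) P' R) (hk : K - n ≤ m + K) (_ : 1 ≤ K - n) (_ : K - n + 1 ≤ m + K)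
      {P'' : Fin (d + 1) → ℕ} (_ : ∀ μ, P' μ = (ℓ + 1) * P'' μ) (_ : ∀ μ, 5 ≤ P'' μ)
      {a : ℕ} (_ : Mh = (ℓ + 1) ^ a) (_ : Mh₀ ≤ Mh) (_ : R₀ ≤ R)
      (w : ℕ → PBond (PV d ℓ m K hd hL) 0 → ℝ) (_ : IsLevWeight (PV d ℓ m K hd hL) (K - n) (B6GlobalChartV1L0.domT hN D hk) w),
      (∃ dBI : PBond (PV d ℓ m K hd hL) 0 → BondIdx (domT hN D hk) → ℝ,
        (∀ b c, distBI (domT hN D hk) b c ≤ dBI b c) ∧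
        (∀ (i : ℕ) (b : PBond (PV d ℓ m K hd hL) 0) (c : BondIdx (domT hN D hk)), i ≤ K - n → (domT hN D hk).InOm i b.src → (c.1.1 : ℕ) < i →
          ((R * ((ℓ + 1) * Mh) - 1 : ℕ) : ℝ) * ((i : ℝ) - (c.1.1 : ℕ) - 1) ≤ dBI b c) ∧
        RowSum162 (PV d ℓ m K hd hL) (K - n) (domT hN D hk) dBI w δ₀ B₃ ∧
        HKernelRows (PV d ℓ m K hd hL) (K - n) (domT hN D hk) dBI w (flatH (PV d ℓ m K hd hL) (K - n) (domT hN D hk)) C δ₀) ∧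
      ∃ (w' : BondIdx (domT hN D hk) → ℝ) (hw' : ∀ i, 0 < w' i) (G : (PBond (PV d ℓ m K hd hL) 0 → ℝ) →ₗ[ℝ] (PBond (PV d ℓ m K hd hL) 0 → ℝ)),
        IsFlatGW (PV d ℓ m K hd hL) (K - n) (domT hN D hk) hw' G ∧ GtSupLetterG (PV d ℓ m K hd hL) (K - n) w G CG ∧
          GtLaplaceLetterG (PV d ℓ m K hd hL) (K - n) w G CG := by
  -- the three port packages at the unit band `b₀ = b₁ = 1`
  obtain ⟨σa, hσa, hA⟩ := cor28_kLevel_H_DH_pad d ℓ hd hL one_pos (le_refl (1 : ℝ))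
  obtain ⟨σb, hσb, hB⟩ := prop27_kLevel_pad d ℓ hd hL one_pos (le_refl (1 : ℝ))
  obtain ⟨σc, hσc, hC⟩ := prop26_2136_lap_kLevel_unconditional_pad_V1 d ℓ hd hL one_pos (le_refl (1 : ℝ))
  set σ : ℝ := min σa (min σb σc) with hσ
  have hσ0 : 0 < σ := lt_min hσa (lt_min hσb hσc)
  have hσa' : σ ≤ σa := min_le_left _ _
  have hσb' : σ ≤ σb := (min_le_right _ _).trans (min_le_left _ _)
  have hσc' : σ ≤ σc := (min_le_right _ _).trans (min_le_right _ _)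
  obtain ⟨δ₅, C₅, M₂a, N₁a, hδ₅, hC₅, hM₂a, hrowsA⟩ := hA σ hσ0 hσa' (1 / 2) (by norm_num) (by norm_num)
  obtain ⟨A', M₂b, cc, N₁b, hA', hM₂b, hcc, hrowsB⟩ := hB σ hσ0 hσb' (1 / 2) (by norm_num) (by norm_num)
  obtain ⟨A, M₂c, hA0, hM₂c, hrowsC⟩ := hC σ hσ0 hσc' (1 / 2) (by norm_num) (by norm_num)
  -- the rates
  set δ₃ : ℝ := delta3 (1 / 2) (2 * σ) with hδ₃
  have hδ₃0 : 0 < δ₃ := delta3_pos (by norm_num) (by linarith)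
  set γ₀ : ℝ := gam0 d ℓ 1 with hγ₀
  have hγ₀0 : 0 < γ₀ := gam0_pos d ℓ zero_le_one
  have hCγ0 : (0 : ℝ) ≤ 2 / γ₀ := div_nonneg zero_le_two hγ₀0.le
  set δ₄ : ℝ := min (δ₃ / 4) (γ₀ / A' / (2 * (1 * (4 / δ₃) * (2 * ((d : ℝ) + 1) * cc)) + 1)) with hδ₄
  have hδ₄0 : 0 < δ₄ := by
    refine lt_min (by linarith) (div_pos (div_pos hγ₀0 hA') ?_)
    have : 0 ≤ 2 * (1 * (4 / δ₃) * (2 * ((d : ℝ) + 1) * cc)) := by positivity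
    linarith
  have hδ₄3 : δ₄ ≤ δ₃ := (min_le_left _ _).trans (by linarith)
  set r : ℝ := (1 - 1 / 16) * (δ₄ / 2) with hr
  have hr0 : 0 < r := by rw [hr]; positivity
  set δ₀ : ℝ := min δ₅ r with hδ₀
  have hδ₀0 : 0 < δ₀ := lt_min hδ₅ hr0
  have hδ₀5 : δ₀ ≤ δ₅ := min_le_left _ _
  have hδ₀r : δ₀ ≤ r := min_le_right _ _
  -- Lemma-2.1 budgets: (2.63) at rate `δ₄/2`, `α′ = 1/16`; (2.61) at rate `δ₀/4` (row sum) and `δ₃/2` (G rows)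
  obtain ⟨hN63pos, hθ63⟩ := theta_budget d ℓ (show 0 < 1 / 16 * (δ₄ / 2) by positivity)
  obtain ⟨hN0pos, hθ0⟩ := theta_budget d ℓ (show 0 < 1 / 4 * δ₀ by positivity)
  obtain ⟨hNgpos, hθg⟩ := theta_budget d ℓ (show 0 < 1 / 2 * δ₃ by positivity)
  set N63 : ℕ := ⌈2 * ((d + 1 : ℕ) : ℝ) * Real.log ((ℓ : ℝ) + 1) / (1 / 16 * (δ₄ / 2))⌉₊ + 1 with hN63
  set N0 : ℕ := ⌈2 * ((d + 1 : ℕ) : ℝ) * Real.log ((ℓ : ℝ) + 1) / (1 / 4 * δ₀)⌉₊ + 1 with hN0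
  set Ng : ℕ := ⌈2 * ((d + 1 : ℕ) : ℝ) * Real.log ((ℓ : ℝ) + 1) / (1 / 2 * δ₃)⌉₊ + 1 with hNg
  set Na4 : ℕ := ⌈2 * ((d : ℝ) + 3) * ((ℓ : ℝ) + 1) / δ₄⌉₊ with hNa4
  set Na0 : ℕ := ⌈2 * ((d : ℝ) + 3) * ((ℓ : ℝ) + 1) / (δ₀ / 4)⌉₊ with hNa0
  set Nag : ℕ := ⌈2 * ((d : ℝ) + 3) * ((ℓ : ℝ) + 1) / δ₃⌉₊ with hNag
  -- the constants
  set Lr : ℝ := (ℓ : ℝ) + 1 with hLr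
  have hL1 : (1 : ℝ) ≤ Lr := by rw [hLr]; linarith [(Nat.cast_nonneg ℓ : (0 : ℝ) ≤ ℓ)]
  set c63 : ℝ := K261 N63 (d + 1) Lr 1 (1 / 16 * (δ₄ / 2)) with hc63
  set K₃ : ℝ := (2 / γ₀) * (2 * (((ℓ + 1 : ℕ) : ℝ)) ^ (d + 1) * Real.exp (δ₃ * ((ℓ : ℝ) + 3))) * Lr ^ 2 * Lr ^ (d + 3) * (2 * ((d : ℝ) + 1)) * c63 ^ 2 with hK₃
  have hK₃0 : 0 ≤ K₃ := by
    have := K261_nonneg (N := N63) (dd := d + 1) (σ := 1 / 16 * (δ₄ / 2)) (by linarith : (0 : ℝ) ≤ Lr) zero_le_one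
    rw [hK₃]; positivity
  set C₁ : ℝ := C₅ * Real.exp (3 * δ₅) with hC₁
  set C₃ : ℝ := K₃ * Real.exp (3 * r) + 1 * Real.exp (r * ((ℓ : ℝ) + 6)) with hC₃
  set C₄ : ℝ := A * (K₃ * Real.exp (3 * r)) with hC₄
  have hC₁0 : 0 ≤ C₁ := by positivity
  have hC₃0 : 0 ≤ C₃ := by positivity
  have hC₄0 : 0 ≤ C₄ := by positivity
  set Cbig : ℝ := max C₁ (max C₃ C₄) with hCbig
  set c1g : ℝ := K261 Ng (d + 1) Lr 1 (1 / 2 * δ₃) with hc1g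
  have hc1g0 : 0 ≤ c1g := K261_nonneg (by linarith : (0 : ℝ) ≤ Lr) zero_le_one
  set B₃ : ℝ := 2 * ((d : ℝ) + 1) * Lr * (1 / (Real.exp 1 * (δ₀ / 8)) + 4) * K261 N0 (d + 1) Lr 1 (1 / 4 * δ₀) with hB₃
  have hB₃0 : 0 ≤ B₃ := by
    have := K261_nonneg (N := N0) (dd := d + 1) (σ := 1 / 4 * δ₀) (by linarith : (0 : ℝ) ≤ Lr) zero_le_one
    have := Real.exp_pos 1
    rw [hB₃]; positivity
  -- the thresholds on `M_h` and `R`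
  set Mh₀ : ℕ := max 8 (max ⌈M₂a⌉₊ (max ⌈M₂b⌉₊ ⌈M₂c⌉₊)) with hMh₀
  set R₀ : ℕ := max (2 * (ℓ + 1) ^ 2) (max (N₁a + 1) (max (N₁b + 1) (max (N63 + 1) (max (N0 + 1) (max (Ng + 1) (max (Na4 + 1) (max (Na0 + 1) (Nag + 1)))))))) with hR₀
  refine ⟨Mh₀, R₀, Cbig, δ₀, B₃ + 1, A * Lr ^ 3 * c1g, hC₁0.trans (le_max_left _ _), hδ₀0, by linarith, by positivity, ?_⟩
  intro m n K Mh R P' hN D hk hk1 hk' P'' hLP hP5 a hMha hMh hR w hw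
  -- unpack the thresholds
  have hM8 : 8 ≤ Mh := le_trans (le_max_left _ _) hMh
  have hMh1 : 1 ≤ Mh := le_trans (by norm_num) hM8
  have hR2 : 2 * (ℓ + 1) ^ 2 ≤ R := le_trans (le_max_left _ _) hR
  have hRMh : 2 ≤ R * Mh := two_le_RMh hR2 hM8
  have hRLM : ∀ {N : ℕ}, N + 1 ≤ R₀ → N + 1 ≤ R * ((ℓ + 1) * Mh) := fun {N} h =>
    le_trans (le_trans h hR) (Nat.le_mul_of_pos_right R (Nat.mul_pos (Nat.succ_pos ℓ) (by omega)))
  have hN₁a : N₁a + 1 ≤ R * ((ℓ + 1) * Mh) := hRLM (le_trans (le_max_left _ _) (le_max_right _ _))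
  have hN₁b : N₁b + 1 ≤ R * ((ℓ + 1) * Mh) := hRLM (le_trans (le_trans (le_max_left _ _) (le_max_right _ _)) (le_max_right _ _))
  have hN63' : N63 + 1 ≤ R * ((ℓ + 1) * Mh) :=
    hRLM (le_trans (le_trans (le_trans (le_max_left _ _) (le_max_right _ _)) (le_max_right _ _)) (le_max_right _ _))
  have hN0' : N0 + 1 ≤ R * ((ℓ + 1) * Mh) :=
    hRLM (le_trans (le_trans (le_trans (le_trans (le_max_left _ _) (le_max_right _ _)) (le_max_right _ _)) (le_max_right _ _)) (le_max_right _ _))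
  have hNg' : Ng + 1 ≤ R * ((ℓ + 1) * Mh) :=
    hRLM (le_trans (le_trans (le_trans (le_trans (le_trans (le_max_left _ _) (le_max_right _ _)) (le_max_right _ _)) (le_max_right _ _)) (le_max_right _ _)) (le_max_right _ _))
  have hNa4' : Na4 + 1 ≤ R * ((ℓ + 1) * Mh) :=
    hRLM (le_trans (le_trans (le_trans (le_trans (le_trans (le_trans (le_max_left _ _) (le_max_right _ _)) (le_max_right _ _)) (le_max_right _ _)) (le_max_right _ _))
      (le_max_right _ _)) (le_max_right _ _))
  have hNa0' : Na0 + 1 ≤ R * ((ℓ + 1) * Mh) :=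
    hRLM (le_trans (le_trans (le_trans (le_trans (le_trans (le_trans (le_trans (le_max_left _ _) (le_max_right _ _)) (le_max_right _ _)) (le_max_right _ _))
      (le_max_right _ _)) (le_max_right _ _)) (le_max_right _ _)) (le_max_right _ _))
  have hNag' : Nag + 1 ≤ R * ((ℓ + 1) * Mh) :=
    hRLM (le_trans (le_trans (le_trans (le_trans (le_trans (le_trans (le_trans (le_max_right _ _) (le_max_right _ _)) (le_max_right _ _)) (le_max_right _ _))
      (le_max_right _ _)) (le_max_right _ _)) (le_max_right _ _)) (le_max_right _ _))
  have hRM1 : 1 ≤ R * ((ℓ + 1) * Mh) := le_trans (by omega) hN0'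
  have hMreal : ∀ {M₂ : ℝ}, ⌈M₂⌉₊ ≤ Mh → M₂ ≤ ((ℓ : ℝ) + 1) * Mh := fun {M₂} h => by
    have h1 : M₂ ≤ (⌈M₂⌉₊ : ℝ) := Nat.le_ceil _
    have h2 : (⌈M₂⌉₊ : ℝ) ≤ (Mh : ℝ) := by exact_mod_cast h
    have h3 : (Mh : ℝ) ≤ ((ℓ : ℝ) + 1) * Mh := le_mul_of_one_le_left (Nat.cast_nonneg _) hL1
    linarith
  have hM₂a' : M₂a ≤ ((ℓ : ℝ) + 1) * Mh := hMreal (le_trans (le_trans (le_max_left _ _) (le_max_right _ _)) hMh)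
  have hM₂b' : M₂b ≤ ((ℓ : ℝ) + 1) * Mh := hMreal (le_trans (le_trans (le_trans (le_max_left _ _) (le_max_right _ _)) (le_max_right _ _)) hMh)
  have hM₂c' : M₂c ≤ ((ℓ : ℝ) + 1) * Mh := hMreal (le_trans (le_trans (le_trans (le_max_right _ _) (le_max_right _ _)) (le_max_right _ _)) hMh)
  have hP1 : ∀ μ, 1 ≤ P' μ := fun μ => by rw [hLP μ]; exact Nat.mul_pos (Nat.succ_pos ℓ) (by have := hP5 μ; omega)
  have hP5L : ∀ μ, 5 * (ℓ + 1) ≤ P' μ := fun μ => by rw [hLP μ, mul_comm]; exact Nat.mul_le_mul_left _ (hP5 μ)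
  -- the band weights
  set ws : BondIdx (domT hN D hk) → ℝ := fun i =>
    ((((ℓ + 1 : ℕ) : ℝ)) ^ (K - n) / (((ℓ + 1 : ℕ) : ℝ)) ^ (i.1.1 : ℕ)) ^ 2 * ((((ℓ + 1 : ℕ) : ℝ)) ^ (i.1.1 : ℕ)) ^ (d + 1) with hws_def
  have hws : ∀ i, 0 < ws i := unitWeights_pos d ℓ hd hL m n K hN D hk
  have hband : GlobalBand (Dm := domT hN D hk) 1 1 ((((ℓ + 1 : ℕ) : ℝ)) ^ (K - n)) ws := globalBand_unitWeights d ℓ hd hL m n K hN D hk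
  -- the port rows at these data
  obtain ⟨hH1, hH2⟩ := hrowsA m K hN D hk hk1 hk' hLP hP5 hMha hM8 hR2 hℓ hM₂a' hN₁a (cf_ne_zero ℓ n K) hws hband
  have h2149 := hrowsB m K hN D hk hk1 hk' hLP hP5 hMha hM8 hR2 hℓ hM₂b' hN₁b (cf_ne_zero ℓ n K) hws hband
  obtain ⟨hGm, hDGm, hLapm⟩ := hrowsC m K hN D hk hk1 hMha hM8 hR2 hP5L hℓ hM₂c' (cf_ne_zero ℓ n K) hws hband
  -- Lemma 2.1 on the torus at the three rates
  obtain ⟨-, -, -, h263⟩ := lemma21_torus (D := D) hMh1 hP1 hN63pos hN63' (div_nonneg hδ₄0.le zero_le_two)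
    (by norm_num : (0 : ℝ) ≤ 1 / 16) (by norm_num : (1 : ℝ) / 16 ≤ 1) hθ63
  obtain ⟨-, h261g, -, -⟩ := lemma21_torus (D := D) hMh1 hP1 hNgpos hNg' hδ₃0.le (by norm_num : (0 : ℝ) ≤ 1 / 2) (by norm_num : (1 : ℝ) / 2 ≤ 1) hθg
  -- absorption thresholds
  obtain ⟨hsm4, -, -⟩ := absorb_budget d ℓ hδ₄0 hNa4'
  obtain ⟨-, -, hsm0⟩ := absorb_budget d ℓ (div_pos hδ₀0 four_pos) hNa0'
  obtain ⟨-, hsmg, -⟩ := absorb_budget d ℓ hδ₃0 hNag'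
  have hsm0' : ((ℓ : ℝ) + 1) ^ 1 * Real.exp (-(δ₀ / 8 * ((R : ℝ) * (((ℓ : ℝ) + 1) * Mh) - 1))) ≤ 1 := by
    have e : δ₀ / 4 / 2 = δ₀ / 8 := by ring
    rw [e] at hsm0; exact hsm0
  refine ⟨⟨fun b c => ((bondT D).dist (blkV1 hN D b) (β hN D hk c) : ℝ) + 3, fun b c => distBI_domT_le hN D hk hMh1 hP1 b c, ?_, ?_, ?_⟩, ?_⟩
  · -- (2.60): the level separation of `d_T`, a fortiori of `d_T + 3`
    intro i b c hi hb hc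
    have h := levelSep_dT d ℓ hd hL m n K hN D hk hMh1 hP1 hi b c hb hc
    linarith
  · -- (162)
    intro b
    have h := rowSum162_domT d ℓ hd hL m n K hN D hk hMh1 hP1 hδ₀0 hN0pos hN0' hθ0 hsm0' w hw b
    exact h.trans (by linarith)
  · -- the four kernel rows
    refine hKernelRows_of_rows d ℓ hd hL m n K hN D hk (C := Cbig) hδ₀5 hδ₀r hC₁0 hC₃0 hC₄0 (le_max_left _ _)
      ((le_max_left _ _).trans (le_max_right _ _)) ((le_max_right _ _).trans (le_max_right _ _)) w ?_ ?_ ?_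
    · intro c e he he' b
      exact hRows12_of_cor28Shape d ℓ hd hL m n K hN D hk hws hH1 hH2 w hw c e he he' b
    · intro c e he he' b
      exact hRow3_of_portShapes d ℓ hd hL m n K hN D hk hRMh hMh1 hP1 hws zero_le_one hband hCγ0 hδ₄0 hδ₄3
        (by norm_num : (1 : ℝ) / 16 ≤ 1) h2149 hsm4 h263 w hw c e he he' b
    · intro c e he he' b
      exact hRow4_of_portShapes d ℓ hd hL m n K hN D hk hRMh hMh1 hP1 hws hA0 hCγ0 hδ₄0 hδ₄3 hLapm h2149 hsm4 h263 w hw c e he he' b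
  · -- the G rows
    obtain ⟨hflat, hsup, hlap⟩ := gRows_of_portShapes d ℓ hd hL m n K hN D hk hMh1 hP1 hRM1 hws hA0 hδ₃0.le hGm hDGm hLapm hsmg h261g w hw
    exact ⟨ws, hws, _, hflat, hsup, hlap⟩


/-- ★ **THE SAME AT EVERY ADMISSIBLE FAMILY OF THE P2 TEXT — NO `Ω₁ = T` HYPOTHESIS** (unit cubes `Λ₀` allowed; file P8's `kernelRowsAt_of_adm22` chart step verbatim, the
separation read on `D.InOm`): for odd `L = ℓ + 1 ≥ 5` there are `M_h⁰, R₀` and `C ≥ 0`, `δ₀ > 0`, `B₃ > 0`, `C_G ≥ 0` such that for all heights `1 ≤ K − n`, `K − n + 1 ≤ m + K`, big blocks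
`M_h = L^{a′} ≥ M_h⁰`, `R ≥ R₀`, torus size `a′ + 3 ≤ m + n`, every `D : Domains (PV d ℓ m K)` with `D.k = K − n`, `Adm22 D R (L·M_h)` and every P2 weight family: `∃ dBI ≥ distBI` with
`(R·L·M_h − 1)·(i − j(c) − 1) ≤ dBI b c` (`b₋ ∈ Ω_i`, `j(c) < i ≤ K − n`), `RowSum162 … dBI w δ₀ B₃`, `HKernelRows … dBI w flatH C δ₀`; and the `G` rows.
[cite: Balaban1984PropagatorsII, (2.1)-(2.4) p.224, (2.46) p.231, (2.60) p.234, Cor. 2.8 (2.150)-(2.151) p.249; Balaban1985Variational, (161)-(163) p.303] -/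
theorem kernelRowsSep_of_adm22 (d ℓ : ℕ) (hd : 1 ≤ d + 1) (hL : Odd (ℓ + 1) ∧ 1 < ℓ + 1) (hℓ : 4 ≤ ℓ) :
    ∃ (Mh₀ R₀ : ℕ) (C δ₀ B₃ CG : ℝ), 0 ≤ C ∧ 0 < δ₀ ∧ 0 < B₃ ∧ 0 ≤ CG ∧
    ∀ (m : ℕ) (n K : ℕ) (_ : 1 ≤ K - n) (_ : K - n + 1 ≤ m + K) {Mh R a' : ℕ} (_ : Mh = (ℓ + 1) ^ a') (_ : Mh₀ ≤ Mh) (_ : R₀ ≤ R) (_ : a' + 3 ≤ m + n)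
      (D : Domains (PV d ℓ m K hd hL)) (_ : D.k = K - n) (_ : Adm22 D R ((ℓ + 1) * Mh))
      (w : ℕ → PBond (PV d ℓ m K hd hL) 0 → ℝ) (_ : IsLevWeight (PV d ℓ m K hd hL) (K - n) D w),
      (∃ dBI : PBond (PV d ℓ m K hd hL) 0 → BondIdx D → ℝ,
        (∀ b c, distBI D b c ≤ dBI b c) ∧
        (∀ (i : ℕ) (b : PBond (PV d ℓ m K hd hL) 0) (c : BondIdx D), i ≤ K - n → D.InOm i b.src → (c.1.1 : ℕ) < i →
          ((R * ((ℓ + 1) * Mh) - 1 : ℕ) : ℝ) * ((i : ℝ) - (c.1.1 : ℕ) - 1) ≤ dBI b c) ∧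
        RowSum162 (PV d ℓ m K hd hL) (K - n) D dBI w δ₀ B₃ ∧
        HKernelRows (PV d ℓ m K hd hL) (K - n) D dBI w (flatH (PV d ℓ m K hd hL) (K - n) D) C δ₀) ∧
      ∃ (w' : BondIdx D → ℝ) (hw' : ∀ i, 0 < w' i) (G : (PBond (PV d ℓ m K hd hL) 0 → ℝ) →ₗ[ℝ] (PBond (PV d ℓ m K hd hL) 0 → ℝ)),
        IsFlatGW (PV d ℓ m K hd hL) (K - n) D hw' G ∧ GtSupLetterG (PV d ℓ m K hd hL) (K - n) w G CG ∧
          GtLaplaceLetterG (PV d ℓ m K hd hL) (K - n) w G CG := by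
  obtain ⟨Mh₀, R₀, C, δ₀, B₃, CG, hC, hδ₀, hB₃, hCG, hmain⟩ := kernelRowsSep_domT d ℓ hd hL hℓ
  refine ⟨Mh₀, R₀, C, δ₀, B₃, CG, hC, hδ₀, hB₃, hCG, ?_⟩
  intro m n K hk1 hk' Mh R a' hMha hMh hR hsize D hDk hAdm w hw
  have hk : K - n ≤ m + K := by omega
  obtain ⟨hN, hLP, hP5⟩ := chart_params d ℓ m n K a' hd hL hℓ hk1 hsize
  rw [hMha] at hAdm
  have hN' : ∀ μ : Fin (d + 1), N0 ℓ Mh (K - n) (fun _ => 2 * (ℓ + 1) ^ (m + n - 1 - a')) μ = (PV d ℓ m K hd hL).sitesPerDir 0 := by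
    rw [hMha]; exact hN
  rw [← hMha] at hAdm
  set D' := FlatPortChartL0.tdOfAdmL0 hN' D hDk hk hAdm with hD'
  have hEq : domT hN' D' hk = D := FlatPortChartL0.domT_tdOfAdmL0 hN' D hDk hk hAdm
  rw [← hEq] at hw ⊢
  exact hmain m n K hN' D' hk hk1 hk' hLP hP5 hMha hMh hR w hw

/-! ## §3 Through P3: the (46), (130) letters and the four (161)₁ letters over a distance carrying (162) AND the level separation -/

/-- ★ **THE `H`-HALF OF THE P2 ROW LIST WITH THE (2.60) LEVEL SEPARATION EXPORTED**, at every admissible family of `PV d ℓ m K` (odd `L ≥ 5`, unit cubes `Λ₀` allowed): the guarded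
(46) letter `HSupLetterG` and the (130) Laplacian row `HLapLetterG` at `max C (C·B₃)`, and `∃ dBI` with `distBI ≤ dBI`, `(R·L·M_h − 1)·(i − j(c) − 1) ≤ dBI b c` (`b₋ ∈ Ω_i`,
`j(c) < i ≤ K − n`), (162) `RowSum162 … δ₀ B₃`, the four (161)₁ rows `HDecayLetterD … (max C (C·B₃)) δ₀` — §2 read through `K0FlatOpsHRowsFromKernelsP.hRows_of_kernelRows`.
[cite: Balaban1985Variational, (46) p.285, (130) p.298, (161)-(162) p.303; Balaban1984PropagatorsII, (2.2) p.224, (2.46) p.231, (2.60) p.234, Cor. 2.8 (2.150)-(2.151) p.249] -/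
theorem hRowsSep_of_adm22 (d ℓ : ℕ) (hd : 1 ≤ d + 1) (hL : Odd (ℓ + 1) ∧ 1 < ℓ + 1) (hℓ : 4 ≤ ℓ) :
    ∃ (Mh₀ R₀ : ℕ) (C δ₀ B₃ : ℝ), 0 ≤ C ∧ 0 < δ₀ ∧ 0 < B₃ ∧
    ∀ (m : ℕ) (n K : ℕ) (_ : 1 ≤ K - n) (_ : K - n + 1 ≤ m + K) {Mh R a' : ℕ} (_ : Mh = (ℓ + 1) ^ a') (_ : Mh₀ ≤ Mh) (_ : R₀ ≤ R) (_ : a' + 3 ≤ m + n)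
      (D : Domains (PV d ℓ m K hd hL)) (_ : D.k = K - n) (_ : Adm22 D R ((ℓ + 1) * Mh))
      (w : ℕ → PBond (PV d ℓ m K hd hL) 0 → ℝ) (_ : IsLevWeight (PV d ℓ m K hd hL) (K - n) D w),
      HSupLetterG (PV d ℓ m K hd hL) (K - n) D w (flatH (PV d ℓ m K hd hL) (K - n) D) C ∧
      HLapLetterG (PV d ℓ m K hd hL) (K - n) D w (flatH (PV d ℓ m K hd hL) (K - n) D) C ∧
      ∃ dBI : PBond (PV d ℓ m K hd hL) 0 → BondIdx D → ℝ,
        (∀ b c, distBI D b c ≤ dBI b c) ∧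
        (∀ (i : ℕ) (b : PBond (PV d ℓ m K hd hL) 0) (c : BondIdx D), i ≤ K - n → D.InOm i b.src → (c.1.1 : ℕ) < i →
          ((R * ((ℓ + 1) * Mh) - 1 : ℕ) : ℝ) * ((i : ℝ) - (c.1.1 : ℕ) - 1) ≤ dBI b c) ∧
        RowSum162 (PV d ℓ m K hd hL) (K - n) D dBI w δ₀ B₃ ∧
        HDecayLetterD (PV d ℓ m K hd hL) (K - n) D dBI w (flatH (PV d ℓ m K hd hL) (K - n) D) C δ₀ := by
  obtain ⟨Mh₀, R₀, C, δ₀, B₃, CG, hC, hδ₀, hB₃, -, hmain⟩ := kernelRowsSep_of_adm22 d ℓ hd hL hℓ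
  refine ⟨Mh₀, R₀, max C (C * B₃), δ₀, B₃, le_max_of_le_left hC, hδ₀, hB₃, ?_⟩
  intro m n K hk1 hk' Mh R a' hMha hMh hR hsize D hDk hAdm w hw
  obtain ⟨⟨dBI, hcomp, hsep, hrow, hk⟩, -⟩ := hmain m n K hk1 hk' hMha hMh hR hsize D hDk hAdm w hw
  obtain ⟨h1, h2, -, h4, h5⟩ := hRows_of_kernelRows hw hDk hC (by linarith) hcomp hk hrow
  exact ⟨h1, h2, dBI, hcomp, hsep, h4, h5⟩

/-! ## §4 NODE 00's four-tori -/

/-- ★★ **THE `H`-HALF OF THE P2 ROW LIST ON NODE 00's FOUR-TORI, THE (2.60) LEVEL SEPARATION OF THE DISTANCE EXPORTED** (the input of the repaired S5 socket): for every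
`F : T4Family` there are `M_h⁰, R₀ : ℕ` and `C ≥ 0`, `δ₀ > 0`, `B₃ > 0` such that for all heights `1 ≤ K − n`, `K − n + 1 ≤ F.m + K`, big blocks `M_h = L^{a′} ≥ M_h⁰`, `R ≥ R₀`,
`a′ + 3 ≤ F.m + n`, every nested family `D : Domains (F.P K)` with `D.k = K − n`, `Adm22 D R (L·M_h)` and every level-weight family `w`: the guarded (46) letter and the (130) row at
`C`, and THERE IS `dBI ≥ distBI` such that `(R·L·M_h − 1)·(i − j(c) − 1) ≤ dBI b c` whenever `b₋ ∈ Ω_i`, `j(c) < i ≤ K − n` ((2.60), walk form of (2.2)), with (162)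
`RowSum162 … dBI w δ₀ B₃` and the four (161)₁ rows `HDecayLetterD … dBI w (flatH …) C δ₀`.  (`F.P K = PV 3 ℓ F.m K`, `rfl`.)
[cite: Balaban1985Variational, (46) p.285, (130) p.298, (161)-(162) p.303; Balaban1984PropagatorsII, (2.2) p.224, (2.46) p.231, (2.60) p.234, Cor. 2.8 (2.150)-(2.151) p.249; Balaban1987RG1, (0.1) p.251] -/
theorem hRowsSep_of_adm22_T4 (F : T4Family) :
    ∃ (Mh₀ R₀ : ℕ) (C δ₀ B₃ : ℝ), 0 ≤ C ∧ 0 < δ₀ ∧ 0 < B₃ ∧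
    ∀ (n K : ℕ) (_ : 1 ≤ K - n) (_ : K - n + 1 ≤ F.m + K) {Mh R a' : ℕ} (_ : Mh = F.L ^ a') (_ : Mh₀ ≤ Mh) (_ : R₀ ≤ R) (_ : a' + 3 ≤ F.m + n)
      (D : Domains (F.P K)) (_ : D.k = K - n) (_ : Adm22 D R (F.L * Mh))
      (w : ℕ → PBond (F.P K) 0 → ℝ) (_ : IsLevWeight (F.P K) (K - n) D w),
      HSupLetterG (F.P K) (K - n) D w (flatH (F.P K) (K - n) D) C ∧
      HLapLetterG (F.P K) (K - n) D w (flatH (F.P K) (K - n) D) C ∧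
      ∃ dBI : PBond (F.P K) 0 → BondIdx D → ℝ,
        (∀ b c, distBI D b c ≤ dBI b c) ∧
        (∀ (i : ℕ) (b : PBond (F.P K) 0) (c : BondIdx D), i ≤ K - n → D.InOm i b.src → (c.1.1 : ℕ) < i →
          ((R * (F.L * Mh) - 1 : ℕ) : ℝ) * ((i : ℝ) - (c.1.1 : ℕ) - 1) ≤ dBI b c) ∧
        RowSum162 (F.P K) (K - n) D dBI w δ₀ B₃ ∧
        HDecayLetterD (F.P K) (K - n) D dBI w (flatH (F.P K) (K - n) D) C δ₀ := by
  obtain ⟨L, hL, h11, m, hm⟩ := F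
  obtain ⟨ℓ, rfl⟩ : ∃ ℓ, L = ℓ + 1 := ⟨L - 1, by omega⟩
  have hℓ : 4 ≤ ℓ := by omega
  obtain ⟨Mh₀, R₀, C, δ₀, B₃, hC, hδ₀, hB₃, hmain⟩ := hRowsSep_of_adm22 3 ℓ hd4 hL hℓ
  refine ⟨Mh₀, R₀, C, δ₀, B₃, hC, hδ₀, hB₃, ?_⟩
  intro n K hk1 hk' Mh R a' hMha hMh hR hsize D hDk hAdm w hw
  exact hmain m n K hk1 hk' hMha hMh hR hsize D hDk hAdm w hw

end Summit.QuantumFields.YangMills.Theorems.K0FlatPortKernelRowsSepP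

end
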